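import Summits.CriticalPhenomena.PercolationContinuityZ3.Theorems.FK.Transplant.KNFreePinning
import Summits.CriticalPhenomena.PercolationContinuityZ3.Theorems.FK.Transplant.KNFreePinningDomainMarkov
import Summits.CriticalPhenomena.PercolationContinuityZ3.Theorems.FK.Transplant.KNFreePinningLaw
import Literature.Probability.Percolation.KozmaNitzanHittable
import HarnessLib

/-!
# FK-continuity transplant, FT-06c: Kozma–Nitzan's weight combinators `pinW`/`restrW` under the edge-weight
# random-cluster law, and the instance "`w ↦ φ^B_{w,q}` is a pinning law"

Cell `fk-continuity` (bschramm), FRONTIER TRANSPLANT sub-cell, registry row FT-06c (pre-G-T1 infrastructure,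
coordinator ruling R15); support file (`--supports stmt-CriticalPhenomena-4575`); builds on p205010 (kernel
theorem, internal audit signed; external expert review pending). HONEST FRAMING: the transplant
`ufsc0_of_freeBoundaryHypothesis_r0` this file serves is CONDITIONAL on the free-boundary penetration hypothesis
FH (open at the same `p` for `q > 1`; ⇔ GRC Conj. (5.103) via the referee's calibration K1; barrier note
`SamePFreeBoundaryCriteria`, Literature/Barriers/CriticalPhenomena, being landed by fkp-barrier); it is a typed
reduction, not a proof of FK continuity. THIS file is unconditional finite-volume measure theory: no named facts,
no sorries, standard axioms; nothing here is specific to `q = 2` or to `d = 3`.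

## What is here

The transplant reuses Kozma–Nitzan's LAW-FREE weightings verbatim (`KSch.Wt`, `KSch.W₀`, `KSch.Wfull` of
`KozmaNitzanScheme.lean` / `KozmaNitzanSteps.lean`: `restrW S (pinW (lattW d p) F ξ)`) and swaps the product law for
the random-cluster law (lead ruling 2026-08-21T01:02Z). This file connects KN's combinators `pinW` (pin the pattern
of `F`) and `restrW` (delete every pair outside `wireSet S`) to FT-05's conditional-parameter API (`condWeights`,
`KNFreePinning*.lean`, Grimmett 2006 Thm. (3.7)):

* `pinW_eq_condWeights : pinW w F T = condWeights w Fᶜ T` and `rcMeasureW_real_inter_localCylinder_pinW` —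
  conditioning `φ^B_{w,q}` on the pattern `T ⊆ F` is the law of the PINNED weighting (FT-05's domain Markov identity
  read in KN's notation);
* `rcMeasureW_real_eq_zero_of_forall_factor`, `rcMeasureW_real_compl_localCylinder_eq_zero`,
  `rcMeasureW_real_inter_localCylinder_of_weights` — weight-one pairs are open and weight-zero pairs closed almost
  surely (so under `φ_{restrW S (pinW w F ξ)}` the pattern on `F` is `ξ` and no pair outside `wireSet S` is open);
* `restrW_le_self`, `restrW_le_restrW_of_subset`, `pinW_le_pinW_of_subset`, `restrW_pinW_le_restrW_pinW` — the
  pointwise comparisons of KN weightings behind REFUTER-REPORT F4 (b)/(c), and their measure forms for `q ≥ 1`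
  (Grimmett (3.22)): `rcMeasureW_pinW_real_le_restrW_pinW_of_isLowerSet` /
  `rcMeasureW_real_inter_localCylinder_le_restrW_of_isLowerSet` (DECREASING-EVENT TRANSFER: the history-conditioned
  law gives a decreasing event at most what the per-direction law `restrW S (pinW w F ξ)` gives it),
  `rcMeasureW_restrW_pinW_real_mono` (REGION/HISTORY MONOTONICITY), `rcMeasureW_restrW_real_mono_region`,
  `rcMeasureW_pinW_real_mono_pattern` (goodness is monotone in the observed pattern);
* `isPinningLaw_rcMeasureW` — for `q ≥ 1`, `w ↦ rcMeasureW w q B` is a pinning law on all of `Sym2 V`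
  (`KNFreePinningLaw.lean`), so KN's chain (36)–(37) (`IsPinningLaw.real_chainEvent_le`, `….real_bad_le`) holds
  under every edge-weight random-cluster law of a finite vertex type.

## References

* G. Grimmett, *The Random-Cluster Model*, Springer 2006: Thm. (3.7) p. 39; Thm. (3.21), eq. (3.22). [Grimmett2006]
* G. Kozma, S. Nitzan, arXiv:2401.12397 (2024), §4 pp. 27–31 ((30), (32), (36)). [KozmaNitzan2024]
* Cell documents: REFUTER-REPORT §8 F4; transplant/prim-bschramm-fkt-p4/FT06-DESIGN.md §2.
-/

noncomputable section

open MeasureTheory Finset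
open scoped ENNReal Classical

namespace Summit.CriticalPhenomena.PercolationContinuityZ3.Theorems.FK

open Transplant

open Literature.Probability.Percolation Literature.Probability.LatticeModels

section Combinators

variable {V : Type*} [Fintype V] (w : Sym2 V → unitInterval)

/-! ### Pinning is conditioning, in KN's notation -/

omit [Fintype V] in
/-- KN's pinned weighting is Grimmett's conditional weight vector for the fresh region `Fᶜ`:
`pinW w F T = condWeights w Fᶜ T`. [cite: Grimmett2006, Thm. (3.7) (p. 39)] -/
theorem pinW_eq_condWeights (F T : Set (Sym2 V)) : pinW w F T = condWeights w Fᶜ T := by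
  funext e
  unfold pinW condWeights
  by_cases he : e ∈ F <;> simp [he]

/-- **Conditioning on the pattern of `F` is pinning**: for `0 < q`, `T ⊆ F` and every event `A`,
`φ^B_{w,q}(A ∩ [T]_F) = φ^B_{w,q}([T]_F) · φ^B_{pinW w F T, q}(A)` (FT-05's `rcMeasureW_real_inter_localCylinder` read
with `pinW`). [cite: Grimmett2006, Thm. (3.7) (p. 39)] -/
theorem rcMeasureW_real_inter_localCylinder_pinW {q : ℝ} (hq : 0 < q) (B : Set V) {F T : Set (Sym2 V)}
    (hT : T ⊆ F) (A : Set (BondConfig V)) :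
    (rcMeasureW w q B).real (A ∩ localCylinder F T) =
      (rcMeasureW w q B).real (localCylinder F T) * (rcMeasureW (pinW w F T) q B).real A := by
  rw [pinW_eq_condWeights]
  exact rcMeasureW_real_inter_localCylinder w hq B hT A

/-! ### Almost sure facts: weight-one pairs are open, weight-zero pairs are closed -/

/-- A configuration of positive mass has nonzero weight. [folklore] -/
theorem rcWeightW_ne_zero_of_real_singleton_ne_zero {q : ℝ} (hq : 0 < q) (B : Set V)
    {ω : BondConfig V} (h : (rcMeasureW w q B).real {ω} ≠ 0) : rcWeightW w q B ω ≠ 0 := by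
  intro h0
  apply h
  rw [rcMeasureW_real_apply w hq B {ω}]
  refine Finset.sum_eq_zero fun ω' _ => ?_
  split_ifs with h1
  · rw [Set.mem_singleton_iff.1 h1, h0, zero_div]
  · rfl

/-- **An event avoided by every configuration of nonzero weight is null**: if every `ω ∈ A` has a pair `e` with
vanishing edge factor (`e ∈ ω` of weight `0`, or `e ∉ ω` of weight `1`), then `φ^B_{w,q}(A) = 0`. [folklore] -/
theorem rcMeasureW_real_eq_zero_of_forall_factor {q : ℝ} (hq : 0 < q) (B : Set V) {A : Set (BondConfig V)}
    (h : ∀ ω ∈ A, ∃ e : Sym2 V, (if e ∈ ω then (w e : ℝ) else 1 - w e) = 0) :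
    (rcMeasureW w q B).real A = 0 := by
  rw [rcMeasureW_real_apply w hq B A]
  refine Finset.sum_eq_zero fun ω _ => ?_
  split_ifs with hω
  · obtain ⟨e, he⟩ := h ω hω
    have hw0 : rcWeightW w q B ω = 0 := by
      unfold rcWeightW BHK2006.weight
      rw [Finset.prod_eq_zero (Finset.mem_univ e) he, zero_mul]
    rw [hw0, zero_div]
  · rfl

/-- **Weight-one pairs are open and weight-zero pairs closed, almost surely**: if `w = 1` on `K ∩ ξ` and `w = 0`
on `K ∖ ξ` then `φ^B_{w,q}([ξ]_Kᶜ) = 0`. In particular under `φ_{restrW S (pinW w F ξ)}` the pattern on `F ∩ wireSet S`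
is `ξ`, and no pair outside `wireSet S` is open, almost surely. [folklore] -/
theorem rcMeasureW_real_compl_localCylinder_eq_zero {q : ℝ} (hq : 0 < q) (B : Set V) {K ξ : Set (Sym2 V)}
    (h1 : ∀ e ∈ K, e ∈ ξ → w e = 1) (h0 : ∀ e ∈ K, e ∉ ξ → w e = 0) :
    (rcMeasureW w q B).real (localCylinder K ξ)ᶜ = 0 := by
  refine rcMeasureW_real_eq_zero_of_forall_factor w hq B fun ω hω => ?_
  simp only [Set.mem_compl_iff, localCylinder, Set.mem_setOf_eq, not_forall] at hω
  obtain ⟨e, heK, hne⟩ := hω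
  refine ⟨e, ?_⟩
  by_cases heξ : e ∈ ξ
  · have heω : e ∉ ω := fun heω => hne (iff_of_true heω heξ)
    rw [if_neg heω, h1 e heK heξ]; simp
  · have heω : e ∈ ω := by
      by_contra heω; exact hne (iff_of_false heω heξ)
    rw [if_pos heω, h0 e heK heξ]; simp

/-- Hence intersecting with the almost sure cylinder does not change probabilities. [folklore] -/
theorem rcMeasureW_real_inter_localCylinder_of_weights {q : ℝ} (hq : 0 < q) (B : Set V)
    {K ξ : Set (Sym2 V)} (h1 : ∀ e ∈ K, e ∈ ξ → w e = 1) (h0 : ∀ e ∈ K, e ∉ ξ → w e = 0)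
    (A : Set (BondConfig V)) :
    (rcMeasureW w q B).real (A ∩ localCylinder K ξ) = (rcMeasureW w q B).real A := by
  haveI := isProbabilityMeasure_rcMeasureW w hq B
  have h0' := rcMeasureW_real_compl_localCylinder_eq_zero w hq B h1 h0
  have hle : (rcMeasureW w q B).real (A \ localCylinder K ξ) = 0 :=
    le_antisymm ((measureReal_mono (Set.sdiff_subset_compl _ _) (measure_ne_top _ _)).trans h0'.le)
      measureReal_nonneg
  have := measureReal_inter_add_sdiff₀ (μ := rcMeasureW w q B) (s := A) (t := localCylinder K ξ)
    (Set.toFinite _).measurableSet.nullMeasurableSet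
  rw [hle, add_zero] at this
  exact this

/-! ### The pointwise comparisons of KN weightings -/

omit [Fintype V] in
/-- Restriction lowers weights: `restrW S w ≤ w`. [folklore] -/
theorem restrW_le_self (S : Set V) (e : Sym2 V) : restrW S w e ≤ w e := by
  by_cases he : e ∈ wireSet S
  · rw [restrW_apply_of_mem w he]
  · rw [restrW_apply_of_not_mem w he]; exact bot_le

omit [Fintype V] in
/-- Restriction is monotone in the region. [folklore] -/
theorem restrW_le_restrW_of_subset {S S' : Set V} (h : S ⊆ S') (e : Sym2 V) : restrW S w e ≤ restrW S' w e := by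
  by_cases he : e ∈ wireSet S
  · rw [restrW_apply_of_mem w he, restrW_apply_of_mem w (show e ∈ wireSet S' from ⟨fun x hx => h (he.1 x hx), he.2⟩)]
  · rw [restrW_apply_of_not_mem w he]; exact bot_le

omit [Fintype V] in
/-- Restriction is monotone in the weights. [folklore] -/
theorem restrW_le_restrW_of_le {w w' : Sym2 V → unitInterval} (h : ∀ e, w e ≤ w' e) (S : Set V) (e : Sym2 V) :
    restrW S w e ≤ restrW S w' e := by
  by_cases he : e ∈ wireSet S
  · rw [restrW_apply_of_mem w he, restrW_apply_of_mem w' he]; exact h e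
  · rw [restrW_apply_of_not_mem w he]; exact bot_le

omit [Fintype V] in
/-- Pinning is monotone in the open pattern. [folklore] -/
theorem pinW_le_pinW_of_subset {F ξ ξ' : Set (Sym2 V)} (h : ξ ∩ F ⊆ ξ') (e : Sym2 V) :
    pinW w F ξ e ≤ pinW w F ξ' e := by
  by_cases heF : e ∈ F
  · by_cases heξ : e ∈ ξ
    · rw [pinW_apply_of_mem_of_mem w heF heξ, pinW_apply_of_mem_of_mem w heF (h ⟨heξ, heF⟩)]
    · rw [pinW_apply_of_mem_of_not_mem w heF heξ]; exact bot_le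
  · rw [pinW_apply_of_not_mem w _ heF, pinW_apply_of_not_mem w _ heF]

omit [Fintype V] in
/-- **The weight comparison of REFUTER-REPORT F4 (c)** (region/history monotonicity) in KN's combinators: the
restricted pinned weighting grows when (i) every pair of the old region pinned OPEN stays pinned open and inside
the new region, and (ii) every pair of the old region left FRESH by the old pinning (and of nonzero weight) lies in
the new region and is not pinned CLOSED by the new pinning.
[cite: KozmaNitzan2024, §4 p. 28 ((32): "the additional information is irrelevant")] -/
theorem restrW_pinW_le_restrW_pinW {S S' : Set V} {F F' ξ ξ' : Set (Sym2 V)}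
    (hopen : ∀ e ∈ wireSet S, e ∈ F → e ∈ ξ → e ∈ wireSet S' ∧ e ∈ F' ∧ e ∈ ξ')
    (hfresh : ∀ e ∈ wireSet S, e ∉ F → w e ≠ 0 → e ∈ wireSet S' ∧ (e ∈ F' → e ∈ ξ')) (e : Sym2 V) :
    restrW S (pinW w F ξ) e ≤ restrW S' (pinW w F' ξ') e := by
  by_cases heS : e ∈ wireSet S
  swap
  · rw [restrW_apply_of_not_mem _ heS]; exact bot_le
  rw [restrW_apply_of_mem _ heS]
  by_cases heF : e ∈ F
  · by_cases heξ : e ∈ ξ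
    · obtain ⟨heS', heF', heξ'⟩ := hopen e heS heF heξ
      rw [pinW_apply_of_mem_of_mem w heF heξ, restrW_apply_of_mem _ heS', pinW_apply_of_mem_of_mem w heF' heξ']
    · rw [pinW_apply_of_mem_of_not_mem w heF heξ]; exact bot_le
  · rw [pinW_apply_of_not_mem w _ heF]
    by_cases hw0 : w e = 0
    · rw [hw0]; exact bot_le
    obtain ⟨heS', hF'ξ'⟩ := hfresh e heS heF hw0
    rw [restrW_apply_of_mem _ heS']
    by_cases heF' : e ∈ F'
    · rw [pinW_apply_of_mem_of_mem w heF' (hF'ξ' heF')]; exact le_top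
    · rw [pinW_apply_of_not_mem w _ heF']

/-! ### The comparisons under `φ^B_{w,q}`, `q ≥ 1` -/

/-- **DECREASING-EVENT TRANSFER** (REFUTER-REPORT F4 (b)) in KN's combinators: for `q ≥ 1`, the law of the
history-pinned weighting `pinW w F ξ` gives a decreasing event at most the probability the per-direction law
`restrW S (pinW w F ξ)` (fresh pairs outside `S` deleted) gives it. [cite: Grimmett2006, Thm. (3.21), eq. (3.22)] -/
theorem rcMeasureW_pinW_real_le_restrW_pinW_of_isLowerSet {q : ℝ} (hq : 1 ≤ q) (B : Set V) (S : Set V)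
    (F ξ : Set (Sym2 V)) {D : Set (BondConfig V)} (hD : IsLowerSet D) :
    (rcMeasureW (pinW w F ξ) q B).real D ≤ (rcMeasureW (restrW S (pinW w F ξ)) q B).real D :=
  rcMeasureW_real_anti_weights_of_isLowerSet (restrW_le_self (pinW w F ξ) S) hq B hD

/-- **DECREASING-EVENT TRANSFER, conditional form**: for `q ≥ 1`, `ξ ⊆ F` and `D` decreasing,
`φ_w(D ∩ [ξ]_F) ≤ φ_w([ξ]_F) · φ_{restrW S (pinW w F ξ)}(D)` — the true law conditioned on the revealed history is
bounded on decreasing events by the per-direction law. [cite: Grimmett2006, Thm. (3.7) (p. 39) and eq. (3.22)] -/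
theorem rcMeasureW_real_inter_localCylinder_le_restrW_of_isLowerSet {q : ℝ} (hq : 1 ≤ q) (B : Set V)
    (S : Set V) {F ξ : Set (Sym2 V)} (hξ : ξ ⊆ F) {D : Set (BondConfig V)} (hD : IsLowerSet D) :
    (rcMeasureW w q B).real (D ∩ localCylinder F ξ) ≤
      (rcMeasureW w q B).real (localCylinder F ξ) * (rcMeasureW (restrW S (pinW w F ξ)) q B).real D := by
  rw [rcMeasureW_real_inter_localCylinder_pinW w (one_pos.trans_le hq) B hξ D]
  exact mul_le_mul_of_nonneg_left (rcMeasureW_pinW_real_le_restrW_pinW_of_isLowerSet w hq B S F ξ hD)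
    measureReal_nonneg

/-- **REGION/HISTORY MONOTONICITY** (REFUTER-REPORT F4 (c)): under the hypotheses of
`restrW_pinW_le_restrW_pinW`, for `q ≥ 1` every increasing event is at least as likely under the later / larger
per-direction law. [cite: Grimmett2006, Thm. (3.21), eq. (3.22); KozmaNitzan2024, §4 p. 28 ((32))] -/
theorem rcMeasureW_restrW_pinW_real_mono {q : ℝ} (hq : 1 ≤ q) (B : Set V) {S S' : Set V}
    {F F' ξ ξ' : Set (Sym2 V)}
    (hopen : ∀ e ∈ wireSet S, e ∈ F → e ∈ ξ → e ∈ wireSet S' ∧ e ∈ F' ∧ e ∈ ξ')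
    (hfresh : ∀ e ∈ wireSet S, e ∉ F → w e ≠ 0 → e ∈ wireSet S' ∧ (e ∈ F' → e ∈ ξ'))
    {A : Set (BondConfig V)} (hA : IsUpperSet A) :
    (rcMeasureW (restrW S (pinW w F ξ)) q B).real A ≤ (rcMeasureW (restrW S' (pinW w F' ξ')) q B).real A :=
  rcMeasureW_real_mono_weights (restrW_pinW_le_restrW_pinW w hopen hfresh) hq B hA

/-- Enlarging only the region (`S ⊆ S'`, same weighting) raises increasing events — KN (32) under `W₀` gives the
hypothesis of Lemma 12 under `Wfull` (`KozmaNitzanSteps` `reach_bound`, where at `q = 1` this was an equality).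
[cite: KozmaNitzan2024, §4 pp. 30–31 (Step IV)] -/
theorem rcMeasureW_restrW_real_mono_region {q : ℝ} (hq : 1 ≤ q) (B : Set V) {S S' : Set V} (h : S ⊆ S')
    (w' : Sym2 V → unitInterval) {A : Set (BondConfig V)} (hA : IsUpperSet A) :
    (rcMeasureW (restrW S w') q B).real A ≤ (rcMeasureW (restrW S' w') q B).real A :=
  rcMeasureW_real_mono_weights (restrW_le_restrW_of_subset w' h) hq B hA

/-- Goodness is monotone in the observed pattern: enlarging the open pattern raises increasing events under the
restricted pinned law (`q ≥ 1`); hence "bad for `x`" is a decreasing event (REFUTER-REPORT F4 (b)).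
[cite: Grimmett2006, Thm. (3.21), eq. (3.22)] -/
theorem rcMeasureW_pinW_real_mono_pattern {q : ℝ} (hq : 1 ≤ q) (B : Set V) (S : Set V) {F ξ ξ' : Set (Sym2 V)}
    (h : ξ ∩ F ⊆ ξ') {A : Set (BondConfig V)} (hA : IsUpperSet A) :
    (rcMeasureW (restrW S (pinW w F ξ)) q B).real A ≤ (rcMeasureW (restrW S (pinW w F ξ')) q B).real A :=
  rcMeasureW_real_mono_weights (restrW_le_restrW_of_le (pinW_le_pinW_of_subset w h) S) hq B hA

/-! ### The instance -/

/-- **`w ↦ φ^B_{w,q}` is a pinning law on all of `Sym2 V`** for `q ≥ 1`: (P) by Grimmett Thm. (3.7) (FT-05's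
domain Markov identity), (M) by (3.22), (S) trivially, (N) by the weight formula. Consequently KN's chain (36)–(37)
(`IsPinningLaw.real_chainEvent_le`, `IsPinningLaw.real_bad_le`) holds under every edge-weight random-cluster law
of a finite vertex type. [cite: Grimmett2006, Thm. (3.7) (p. 39) and eq. (3.22)] -/
theorem isPinningLaw_rcMeasureW {q : ℝ} (hq : 1 ≤ q) (B : Set V) :
    IsPinningLaw (fun w : Sym2 V → unitInterval => rcMeasureW w q B) Set.univ where
  prob w := isProbabilityMeasure_rcMeasureW w (one_pos.trans_le hq) B
  pin w _ _ _ hT A _ := rcMeasureW_real_inter_localCylinder_pinW w (one_pos.trans_le hq) B (Finset.coe_subset.2 hT) A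
  mono _ _ hle _ hA _ := rcMeasureW_real_mono_weights (fun e => hle e (Set.mem_univ e)) hq B hA
  subset w := by
    have : ({ω : BondConfig V | ω ⊆ Set.univ}ᶜ : Set (BondConfig V)) = ∅ :=
      Set.compl_empty_iff.2 (Set.eq_univ_of_forall fun ω => Set.subset_univ ω)
    rw [this, measureReal_empty]
  null w _ _ _ _ h1 h0 := rcMeasureW_real_compl_localCylinder_eq_zero w (one_pos.trans_le hq) B h1 h0

end Combinators

end Summit.CriticalPhenomena.PercolationContinuityZ3.Theorems.FK

end
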